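import Literature.NumberTheory.Rogawski1990.ArchTorusOrbitalCompactWallLimitsGlobal   -- ★ LH3-p04 (g2) brick A (compact-wall partners); brings ★ (C-bdry-glob) p849626, ★ (δ), ★ J1
import Literature.NumberTheory.Rogawski1990.ArchExplicitTransferFactorCayleyTorus     -- ★ p849548 (Δ-def-explicit)+(κ-TABLE): `archExplicitDelta_cayleyTorus_relabel_eq_mul`, Laurent form of `τ·D_{G/H}`
import HarnessLib

/-!
# (M2-01-curve) The `Δ″`-side of `Θ ∈ C_c^∞(G′_∞)` is continuous WITH ITS FIRST DERIVATIVE across a `G`-wall of `H_∞` along the normal curve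
# (Rogawski 1990 §4.9 p. 59, §8.2 pp. 119–124; Shelstad 1979 §2, §4; Varadarajan 1989 §6.4; Langlands–Shelstad 1987 §2.4)

Topic `NumberTheory/Rogawski1990`; namespace `Literature.NumberTheory.Rogawski1990`.  THEOREMS ONLY (no `def`, no instance, no notation, no axiom, no named fact, no `sorry`).
Cell `pub/hodgecm-mathlib`, line LH3 (closer stub `stub_N9`, crux H413 = `stmt-HodgeConjecture-24833`), organ **(M2-01)** of the direct road (LH3-plan (g2) MEMO-N9-direct-road,
05:33∕05:36Z; CURVE SCOPE accepted ibid.): «THE FIRST IN-HOUSE ENDOSCOPIC TRANSFER STATEMENT AT ∞, orders 0 and 1, compact chart, ANY signature».  Author LH3-p04 (g2).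

SETTING.  `L` CM, `α : Fin 3 → L` hermitian nonzero weights, `G′_∞ = U(diag α)(L⁺ ⊗ ℝ) ≃ₜ* Π_v G_v` with `ν_∞ = e⁻¹_*(⊗_v ν_v)` (per-place Haar measures), the Cayley-frame `H`-family
`γ_H(y)` (equality binder `hγH`, ★ (W1-cont)): 2-block eigenvalues `y_{v,0}, y_{v,2}`, 1-block eigenvalue `y_{v,1}`; its six-per-place partners `t(y ∘ ρ)` (★ `isArchNormPair_cayleyTorus_relabel`);
the explicit transfer factor `Δ″ = archExplicitDelta L (diag α) (γ_H y) μ` (`μ` a Hecke character of `L` restricting to `ω_{L/L⁺}`, hypothesis `hμω` — the (μ-guard)); an ambient-smooth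
`Θ : M₃(L ⊗ ℝ) → ℂ` compactly supported on the group.  THE `G`-WALL AND ITS NORMAL CURVE: fix a place `w` and a base point `z` regular at every `v ≠ w` with `z_{w,0} = z_{w,2} ≠ z_{w,1}`
(★ (C-bdry) conventions), the one-angle curve `z^ψ = update z w (i ↦ z_{w,i} e^{i(1,0,−1)_i ψ})` and `σ = (1 2)`.  The `H`-point `y(ψ) := (z^ψ_v ∘ σ)_v` has, at `w`, 2-block
eigenvalues `(ζ₀e^{iψ}, ζ₁)` and 1-block eigenvalue `ζ₀e^{−iψ}`: `ψ ↦ γ_H(y(ψ))` is the normal curve through the `G`-singular, `H`-regular point `y(0)` («`z₁ = z₀`» inside «`z₀ ≠ z₂`»),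
`G`-regular for small `ψ ≠ 0`; its partners are `t(z^ψ ∘ ρ)`, `ρ : W → S₃` (the `G`-slot `i` at `v` carries `z^ψ_v(ρ_v i)`).

THE STATEMENT (M2-01-curve).  `F(ψ) := Σ_{ρ : W → S₃} Δ″(γ_H(y(ψ)), t(z^ψ∘ρ)) · ∫_{G′_∞} Θ(↑↑(g·t(z^ψ∘ρ)·g⁻¹)) dν_∞` has a two-sided limit `A` as `ψ → 0, ψ ≠ 0`, is differentiable at
every small `ψ ≠ 0`, and `F′` has a two-sided limit `B` there: the `Δ″`-weighted sum of orbital integrals of `Θ` EXTENDS `C¹` ACROSS THE `G`-WALL along the normal curve.  (The leaf's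
class-function transfer `Σᶠ_{c′} Δ″(γ_H, c′)·O(c′)` (★ (W1-cont)) is `N⁻¹·F` on the `G`-regular set, `N` = the common size of the fibres `ρ ↦ class of t(z^ψ∘ρ)`, a constant.)

THE MECHANISM (Rogawski §8.2 pp. 122–124 «the jumps of the unstable orbital integrals at `γ₂ → γ₀′` are killed by `κ`»; Shelstad 1979 §4).  By ★ (Δ-def-explicit)
`Δ″(γ_H(y), t(y∘ρ′)) = K_{ρ′}·(τ·D_{G/H})(γ_H(y))` with `K_{ρ′} = Π_v sign(re σ_v α_{ρ′_v⁻¹(1)})·η_v` LOCALLY CONSTANT, and by the Laurent form ★ `exists_archTau_mul_archWeylRatio_cayleyTorus_eq`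
(this is where `hμω` is load-bearing) `(τ·D_{G/H})(γ_H(y(ψ))) = 2 sin ψ · S(ψ)` with `S(ψ) = C·(ζ₀ζ₁)^k·i·(ζ₀e^{ikψ} − ζ₁e^{i(k+1)ψ})` ENTIRE — the simple zero of `D_{G/H}` at the wall
is carried by `2 sin ψ`.  Hence `F = S · H`, `H(ψ) = Σ_ρ K_ρ · g_ρ(ψ)`, `g_ρ(ψ) = 2 sin ψ · O_ρ(ψ)`.  Each `g_ρ` has one-sided limits `Jp_ρ, Jm_ρ` and `g_ρ′ → D_ρ` two-sidedly: at a
NONCOMPACT `w`-wall (`re σ_w α_{ρ_w⁻¹0} · re σ_w α_{ρ_w⁻¹2} < 0`) by ★ (C-bdry-glob), at a COMPACT one by ★ brick A (`Jp_ρ = Jm_ρ = 0`).  THE JUMP CANCELS IN MIRROR PAIRS: the partner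
`ρ° := update ρ w ((0 2)·ρ_w)` satisfies `t(z^ψ∘ρ°) = t(z^{−ψ}∘ρ)` (uses `z_{w,0} = z_{w,2}`), so `g_{ρ°}(ψ) = −g_ρ(−ψ)` and `Jm_{ρ°} = −Jp_ρ`; and `K_{ρ°} = −K_ρ` exactly when the
`w`-wall of `ρ` is noncompact (★ (κ-TABLE): `ρ_w⁻¹` of the 1-block slot moves between lines of opposite sign).  Re-indexing `Σ_ρ K_ρ Jm_ρ` by the involution `ρ ↦ ρ°` gives
`Σ_ρ K_ρ Jp_ρ` (compact partners contribute `0` to both), so `H(0⁻) = H(0⁺)`; `H′ → Σ K_ρ D_ρ` needs no pairing.  Finally `F = S·H`, `F′ = S′H + SH′`.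

WHAT IS PROVED.
* `differentiableAt_two_sin_mul_integral_comp_conj_archDiagTorus_update_splitCurve_comp` — `g_ρ` is differentiable at every regular parameter `ψ` (★ (δ) Fubini identity on the open
  regular set + ★ J1 per place);
* **`exists_tendsto_sum_archExplicitDelta_mul_integral_splitCurve_gWall`** — THE HEAD: `∃ A B`, `F → A` and `F′ → B` along `𝓝[≠] 0`.
NOT CLAIMED (census (4), planner «=»): the hypersurface statement (C¹-extension of the all-angles function across the wall), which needs (C-bdry) locally uniform in the base point
(board item (C-bdry-unif)); the general chart `endoTorus S c` (organ (I₁-Δ-S)); higher normal derivatives (Bouaziz (I₂)).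
HONEST LABEL: HC_CM is proved only modulo the 7 printed citations (2 remaining: hLiu418 = stmt-HodgeConjecture-24832, h413 = stmt-HodgeConjecture-24833) until rung 0 closes; this organ is
(M2) of three for `stub_N9`'s L2 and pays nothing by itself.

## References
* [Rogawski1990] J. D. Rogawski, *Automorphic Representations of Unitary Groups in Three Variables*, Ann. of Math. Stud. 123 (1990), §4.9 p. 59, §8.2 pp. 119–124.
* [Shelstad1979] D. Shelstad, *Characters and inner forms of a quasi-split group over ℝ*, Compositio Math. 39 (1979) 11–45, §2, §4.
* [Varadarajan1989] V. S. Varadarajan, *An Introduction to Harmonic Analysis on Semisimple Lie Groups* (1989), §6.4 Thm 18, Thm 20, Thm 22.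
* [LanglandsShelstad1987] R. P. Langlands, D. Shelstad, *On the definition of transfer factors*, Math. Ann. 278 (1987), §2.4.
-/

set_option autoImplicit false

noncomputable section

open MeasureTheory Measure Filter Topology NumberField NumberField.InfinitePlace NumberField.mixedEmbedding Equiv Function Set
open Literature.MeasureTheory.Group Literature.NumberTheory.Automorphic Literature.NumberTheory.Automorphic.UnitaryGroup Literature.NumberTheory.GaloisRepresentations
open Literature.LinearAlgebra.Matrix
open scoped Matrix MatrixGroups Matrix.Norms.Operator ContDiff ComplexConjugate

namespace Literature.NumberTheory.Rogawski1990

/-- The scalar identity at the moving place: with `e = e^{iψ}`, `−(((ζ₀e·ζ₁)^k·((ζ₀ē − ζ₀e)(ζ₀ē − ζ₁)))/(ζ₀ē)) = 2 sin ψ · ((ζ₀ζ₁)^k · i·(ζ₀e^{ikψ} − ζ₁e^{i(k+1)ψ}))` — the `w`-factor of the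
Laurent form of `τ·D_{G/H}` along the normal curve, with its simple zero `ē − e = −2i sin ψ` factored out. [cite: Rogawski1990, §8.2 p. 122] -/
private theorem gWall_place_factor_eq (ζ₀ ζ₁ : ℂ) (hζ₀ : ζ₀ ≠ 0) (k : ℤ) (ψ : ℝ) :
    -(((((ζ₀ * Complex.exp (ψ * Complex.I)) * ζ₁) ^ k) * (((ζ₀ * Complex.exp (-(ψ * Complex.I))) - ζ₀ * Complex.exp (ψ * Complex.I)) *
        ((ζ₀ * Complex.exp (-(ψ * Complex.I))) - ζ₁))) / (ζ₀ * Complex.exp (-(ψ * Complex.I)))) =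
      (2 * Real.sin ψ : ℂ) * ((ζ₀ * ζ₁) ^ k * (Complex.I * (ζ₀ * Complex.exp (k * ψ * Complex.I) - ζ₁ * Complex.exp ((k + 1) * ψ * Complex.I)))) := by
  set e : ℂ := Complex.exp (ψ * Complex.I) with he
  have he0 : e ≠ 0 := Complex.exp_ne_zero _
  have hI : Complex.I * Complex.I = -1 := Complex.I_mul_I
  have hsin : (2 * Real.sin ψ : ℂ) = (e⁻¹ - e) * Complex.I := by
    rw [Complex.ofReal_sin, Complex.sin, he, ← Complex.exp_neg, neg_mul]
    field_simp
  have hE : Complex.exp (k * ψ * Complex.I) = e ^ k := by rw [he, ← Complex.exp_int_mul, mul_assoc]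
  have hE1 : Complex.exp ((k + 1) * ψ * Complex.I) = e ^ k * e := by rw [add_mul, add_mul, one_mul, Complex.exp_add, hE]
  rw [Complex.exp_neg, hsin, hE, hE1, show (ζ₀ * e * ζ₁) ^ k = (ζ₀ * ζ₁) ^ k * e ^ k by rw [← mul_zpow]; ring_nf]
  rw [show (e⁻¹ - e) * Complex.I * ((ζ₀ * ζ₁) ^ k * (Complex.I * (ζ₀ * e ^ k - ζ₁ * (e ^ k * e)))) = -((e⁻¹ - e) * ((ζ₀ * ζ₁) ^ k * (ζ₀ * e ^ k - ζ₁ * (e ^ k * e)))) from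
    by linear_combination ((e⁻¹ - e) * ((ζ₀ * ζ₁) ^ k * (ζ₀ * e ^ k - ζ₁ * (e ^ k * e)))) * hI]
  field_simp
  ring

section GWall

variable (L : Type) [Field L] [NumberField L] [IsCMField L] (α : Fin 3 → L) (w : {w : InfinitePlace L // IsComplex w})
  [MeasurableSpace (GL (Fin 3) ℂ)] [BorelSpace (GL (Fin 3) ℂ)]
  [MeasurableSpace (arch (↥(maximalRealSubfield L)) L (IsCMField.complexConj L) 3 (Matrix.diagonal α))] [BorelSpace (arch (↥(maximalRealSubfield L)) L (IsCMField.complexConj L) 3 (Matrix.diagonal α))]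

open scoped Classical in
/-- **`g_ρ` IS DIFFERENTIABLE AT EVERY REGULAR PARAMETER**: for `ψ` with `z^ψ_w` regular (and `z` regular off `w`),
`ψ ↦ 2 sin ψ · ∫_{G′_∞} Θ(↑↑(g·t(z^ψ∘ρ)·g⁻¹)) dν_∞` is differentiable at `ψ` (on the open regular set it is the per-place function of the partial orbital lambda, ★ (δ) + ★ J1).
[cite: Rogawski1990, §8.2 p. 122] [cite: Varadarajan1989, §6.4 Thm 18] -/
theorem differentiableAt_two_sin_mul_integral_comp_conj_archDiagTorus_update_splitCurve_comp
    (νw : ∀ v : {w : InfinitePlace L // IsComplex w}, Measure (archLocal L 3 (Matrix.diagonal α) v)) [∀ v, (νw v).IsHaarMeasure]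
    (hα : ∀ i, α i ≠ 0) (hherm : ∀ i, (IsCMField.complexConj L (α i) : L) = α i)
    (Θ : Matrix (Fin 3) (Fin 3) (mixedSpace L) → ℂ) (hΘ : ContDiff ℝ (⊤ : ℕ∞) Θ)
    (hΘc : HasCompactSupport fun g : arch (↥(maximalRealSubfield L)) L (IsCMField.complexConj L) 3 (Matrix.diagonal α) => Θ ((g : GL (Fin 3) (mixedSpace L)) : Matrix (Fin 3) (Fin 3) (mixedSpace L)))
    (z : {w : InfinitePlace L // IsComplex w} → Fin 3 → Circle) (hz : ∀ v, v ≠ w → Function.Injective (z v))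
    (ρ : {w : InfinitePlace L // IsComplex w} → Perm (Fin 3)) {ψ : ℝ} (hψ : Function.Injective fun i => z w i * Circle.exp (![(1 : ℝ), 0, -1] i * ψ)) :
    DifferentiableAt ℝ (fun ψ : ℝ => (2 * Real.sin ψ : ℂ) *
        ∫ g, Θ (((g * archDiagTorus L 3 α (fun v => Function.update z w (fun i => z w i * Circle.exp (![(1 : ℝ), 0, -1] i * ψ)) v ∘ ⇑(ρ v)) * g⁻¹ :
          arch (↥(maximalRealSubfield L)) L (IsCMField.complexConj L) 3 (Matrix.diagonal α)) : GL (Fin 3) (mixedSpace L)) : Matrix (Fin 3) (Fin 3) (mixedSpace L))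
          ∂((Measure.pi νw).map (archPiEquivCM 3 L (Matrix.diagonal α)).symm)) ψ := by
  have hreal : ∀ i, (w.1.embedding (α i)).im = 0 := fun i => im_embedding_eq_zero_of_complexConj_eq L w (hherm i)
  haveI : ∀ v : {w : InfinitePlace L // IsComplex w}, LocallyCompactSpace (archLocal L 3 (Matrix.diagonal α) v) := fun v => locallyCompactSpace_archLocal L 3 (Matrix.diagonal α) v
  haveI : ∀ v : {w : InfinitePlace L // IsComplex w}, SecondCountableTopology (archLocal L 3 (Matrix.diagonal α) v) := fun v => secondCountableTopology_archLocal L 3 (Matrix.diagonal α) v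
  obtain ⟨Θ', hΘ', hΘ'c, hΘ'eq⟩ := exists_contDiff_partialOrbital_eq L 3 α νw hα w Θ hΘ hΘc (z := fun v => z v ∘ ⇑(ρ v))
    (fun v hv => (hz v hv).comp (ρ v).injective)
  have hΘ'1 : ContDiff ℝ 1 Θ' := hΘ'.of_le (by exact_mod_cast le_top)
  set T : Set ℝ := {ψ | Function.Injective fun i => z w i * Circle.exp (![(1 : ℝ), 0, -1] i * ψ)} with hT
  have hTopen : IsOpen T := isOpen_setOf_injective.preimage (continuous_torusCurve (z w) ![(1 : ℝ), 0, -1])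
  have heq : ∀ ψ ∈ T, (2 * Real.sin ψ : ℂ) *
      ∫ g, Θ (((g * archDiagTorus L 3 α (fun v => Function.update z w (fun i => z w i * Circle.exp (![(1 : ℝ), 0, -1] i * ψ)) v ∘ ⇑(ρ v)) * g⁻¹ :
        arch (↥(maximalRealSubfield L)) L (IsCMField.complexConj L) 3 (Matrix.diagonal α)) : GL (Fin 3) (mixedSpace L)) : Matrix (Fin 3) (Fin 3) (mixedSpace L))
        ∂((Measure.pi νw).map (archPiEquivCM 3 L (Matrix.diagonal α)).symm) =
      (2 * Real.sin ψ : ℂ) * ∫ g : archLocal L 3 (Matrix.diagonal α) w,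
        Θ' ((((g * ⟨circleDiagonal 3 ((fun i => z w i * Circle.exp (![(1 : ℝ), 0, -1] i * ψ)) ∘ ⇑(ρ w)), circleDiagonal_mem_archLocal_diagonal L 3 α w _⟩ * g⁻¹ :
          archLocal L 3 (Matrix.diagonal α) w) : GL (Fin 3) ℂ) : Matrix (Fin 3) (Fin 3) ℂ)) ∂(νw w) := by
    intro ψ hψ
    have hreg : ∀ v, Function.Injective (Function.update z w (fun i => z w i * Circle.exp (![(1 : ℝ), 0, -1] i * ψ)) v ∘ ⇑(ρ v)) := by
      intro v
      by_cases hv : v = w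
      · subst hv; rw [Function.update_self]; exact (show Function.Injective _ from hψ).comp (ρ v).injective
      · rw [Function.update_of_ne hv]; exact (hz v hv).comp (ρ v).injective
    rw [integral_comp_conj_archDiagTorus_update_comp_eq_integral_partial L α w νw hα Θ hΘ.continuous hΘc z _ ρ hreg]
    congr 1
    refine integral_congr_ae (Eventually.of_forall fun x => ?_)
    exact (hΘ'eq _).symm
  have hloc : DifferentiableAt ℝ (fun ψ : ℝ => (2 * Real.sin ψ : ℂ) * ∫ g : archLocal L 3 (Matrix.diagonal α) w,
      Θ' ((((g * ⟨circleDiagonal 3 ((fun i => z w i * Circle.exp (![(1 : ℝ), 0, -1] i * ψ)) ∘ ⇑(ρ w)), circleDiagonal_mem_archLocal_diagonal L 3 α w _⟩ * g⁻¹ :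
        archLocal L 3 (Matrix.diagonal α) w) : GL (Fin 3) ℂ) : Matrix (Fin 3) (Fin 3) ℂ)) ∂(νw w)) ψ :=
    (((Real.hasDerivAt_sin ψ).ofReal_comp).const_mul (2 : ℂ)).differentiableAt.mul
      (differentiableAt_integral_comp_conj_splitCurve_comp_perm L α w hα hreal (νw w) Θ' hΘ'1 hΘ'c (z w) (ρ w) hψ)
  exact hloc.congr_of_eventuallyEq (Filter.eventually_of_mem (hTopen.mem_nhds hψ) fun ψ' hψ' => heq ψ' hψ')

variable
  (γH : ({w : InfinitePlace L // IsComplex w} → Fin 3 → Circle) →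
    ↥(UnitaryGroup.arch (↥(maximalRealSubfield L)) L (IsCMField.complexConj L) 2
        (Matrix.of fun i j : Fin 2 => if i.val + j.val + 1 = 2 then (1 : L) else 0)) ×
      ↥(UnitaryGroup.arch (↥(maximalRealSubfield L)) L (IsCMField.complexConj L) 1
        (Matrix.of fun i j : Fin 1 => if i.val + j.val + 1 = 1 then (1 : L) else 0)))
  (hγH : γH = fun z =>
    ((UnitaryGroup.archPiEquivCM 2 L (Matrix.of fun i j : Fin 2 => if i.val + j.val + 1 = 2 then (1 : L) else 0)).symm fun w =>
        ⟨Matrix.GeneralLinearGroup.mkOfDetNeZero !![(1 : ℂ), 1; 1, -1] UnitaryGroup.det_cayleyTwo_ne_zero *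
            UnitaryGroup.circleDiagonal 2 ![z w 0, z w 2] *
          (Matrix.GeneralLinearGroup.mkOfDetNeZero !![(1 : ℂ), 1; 1, -1] UnitaryGroup.det_cayleyTwo_ne_zero)⁻¹,
          UnitaryGroup.cayley_conj_circleDiagonal_mem_archLocal L w _⟩,
      (UnitaryGroup.archPiEquivCM 1 L (Matrix.of fun i j : Fin 1 => if i.val + j.val + 1 = 1 then (1 : L) else 0)).symm fun w =>
        ⟨UnitaryGroup.circleDiagonal 1 ![z w 1], UnitaryGroup.circleDiagonal_mem_archLocal_antidiagOne L w _⟩))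
  (μ : HeckeCharacter L)

include hγH in
open scoped Classical in
/-- (M2-01-curve) with the curve as an equality binder `c = (ψ ↦ (z_{w,i} e^{i(1,0,−1)_i ψ})_i)` (proof engine of the next theorem; instantiate with `rfl`).
[cite: Rogawski1990, §8.2 pp. 122–124] [cite: Shelstad1979, §4] [cite: Varadarajan1989, §6.4 Thm 18, Thm 20, Thm 22] -/
theorem exists_tendsto_sum_archExplicitDelta_mul_integral_splitCurve_gWall_aux
    (νw : ∀ v : {w : InfinitePlace L // IsComplex w}, Measure (archLocal L 3 (Matrix.diagonal α) v)) [∀ v, (νw v).IsHaarMeasure]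
    (hα : ∀ i, α i ≠ 0) (hherm : ∀ i, (IsCMField.complexConj L (α i) : L) = α i)
    (hμω : ∀ x : ideleGroup ↥(maximalRealSubfield L), μ (AdeleRing.ideleBaseChange (↥(maximalRealSubfield L)) L x) = quadraticHeckeCharCM L x)
    (Θ : Matrix (Fin 3) (Fin 3) (mixedSpace L) → ℂ) (hΘ : ContDiff ℝ (⊤ : ℕ∞) Θ)
    (hΘc : HasCompactSupport fun g : arch (↥(maximalRealSubfield L)) L (IsCMField.complexConj L) 3 (Matrix.diagonal α) => Θ ((g : GL (Fin 3) (mixedSpace L)) : Matrix (Fin 3) (Fin 3) (mixedSpace L)))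
    (z : {w : InfinitePlace L // IsComplex w} → Fin 3 → Circle) (hz : ∀ v, v ≠ w → Function.Injective (z v)) (h02 : z w 0 = z w 2) (h01 : z w 0 ≠ z w 1)
    (c : ℝ → Fin 3 → Circle) (hc : c = fun ψ i => z w i * Circle.exp (![(1 : ℝ), 0, -1] i * ψ)) :
    ∃ A B : ℂ,
      Tendsto (fun ψ : ℝ => ∑ ρ : {w : InfinitePlace L // IsComplex w} → Perm (Fin 3),
          archExplicitDelta L (Matrix.diagonal α) (γH fun v => Function.update z w (c ψ) v ∘ ⇑(Equiv.swap (1 : Fin 3) 2)) μ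
              (archDiagTorus L 3 α fun v => Function.update z w (c ψ) v ∘ ⇑(ρ v)) *
            ∫ g, Θ (((g * archDiagTorus L 3 α (fun v => Function.update z w (c ψ) v ∘ ⇑(ρ v)) * g⁻¹ :
              arch (↥(maximalRealSubfield L)) L (IsCMField.complexConj L) 3 (Matrix.diagonal α)) : GL (Fin 3) (mixedSpace L)) : Matrix (Fin 3) (Fin 3) (mixedSpace L))
              ∂((Measure.pi νw).map (archPiEquivCM 3 L (Matrix.diagonal α)).symm)) (𝓝[≠] 0) (𝓝 A) ∧
      Tendsto (fun ψ : ℝ => deriv (fun ψ : ℝ => ∑ ρ : {w : InfinitePlace L // IsComplex w} → Perm (Fin 3),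
          archExplicitDelta L (Matrix.diagonal α) (γH fun v => Function.update z w (c ψ) v ∘ ⇑(Equiv.swap (1 : Fin 3) 2)) μ
              (archDiagTorus L 3 α fun v => Function.update z w (c ψ) v ∘ ⇑(ρ v)) *
            ∫ g, Θ (((g * archDiagTorus L 3 α (fun v => Function.update z w (c ψ) v ∘ ⇑(ρ v)) * g⁻¹ :
              arch (↥(maximalRealSubfield L)) L (IsCMField.complexConj L) 3 (Matrix.diagonal α)) : GL (Fin 3) (mixedSpace L)) : Matrix (Fin 3) (Fin 3) (mixedSpace L))
              ∂((Measure.pi νw).map (archPiEquivCM 3 L (Matrix.diagonal α)).symm)) ψ) (𝓝[≠] 0) (𝓝 B) := by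
  -- ABBREVIATIONS (opaque, with defining equations): the orbital function `g_ρ`, the sign product `K_ρ`
  obtain ⟨G, hG⟩ : ∃ G : ({w : InfinitePlace L // IsComplex w} → Perm (Fin 3)) → ℝ → ℂ, G = fun (ρ : {w : InfinitePlace L // IsComplex w} → Perm (Fin 3)) (ψ : ℝ) => (2 * Real.sin ψ : ℂ) *
      ∫ g, Θ (((g * archDiagTorus L 3 α (fun v => Function.update z w (c ψ) v ∘ ⇑(ρ v)) * g⁻¹ :
        arch (↥(maximalRealSubfield L)) L (IsCMField.complexConj L) 3 (Matrix.diagonal α)) : GL (Fin 3) (mixedSpace L)) : Matrix (Fin 3) (Fin 3) (mixedSpace L))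
        ∂((Measure.pi νw).map (archPiEquivCM 3 L (Matrix.diagonal α)).symm) := ⟨_, rfl⟩
  obtain ⟨K, hK⟩ : ∃ K : ({w : InfinitePlace L // IsComplex w} → Perm (Fin 3)) → ℤ, ∀ ρ, K ρ =
      (∏ v : {w : InfinitePlace L // IsComplex w}, ((SignType.sign ((v.1.embedding (α ((Equiv.swap (1 : Fin 3) 2 * ρ v).symm 1))).re) : ℤ) * archMajoritySign L (Matrix.diagonal α) v)) :=
    ⟨fun ρ => _, fun ρ => rfl⟩
  have hGρ : ∀ ρ : {w : InfinitePlace L // IsComplex w} → Perm (Fin 3), G ρ = fun ψ : ℝ => (2 * Real.sin ψ : ℂ) *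
      ∫ g, Θ (((g * archDiagTorus L 3 α (fun v => Function.update z w (fun i => z w i * Circle.exp (![(1 : ℝ), 0, -1] i * ψ)) v ∘ ⇑(ρ v)) * g⁻¹ :
        arch (↥(maximalRealSubfield L)) L (IsCMField.complexConj L) 3 (Matrix.diagonal α)) : GL (Fin 3) (mixedSpace L)) : Matrix (Fin 3) (Fin 3) (mixedSpace L))
        ∂((Measure.pi νw).map (archPiEquivCM 3 L (Matrix.diagonal α)).symm) := by
    intro ρ; subst hc hG; rfl
  have hcψ : ∀ ψ : ℝ, c ψ = fun i => z w i * Circle.exp (![(1 : ℝ), 0, -1] i * ψ) := fun ψ => by subst hc; rfl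
  have hreal : ∀ i, (w.1.embedding (α i)).im = 0 := fun i => im_embedding_eq_zero_of_complexConj_eq L w (hherm i)
  have hne : ∀ i, (w.1.embedding (α i)).re ≠ 0 := fun i h =>
    hα i (w.1.embedding.injective (by rw [map_zero]; exact Complex.ext h (hreal i)))
  have h12 : z w 1 ≠ z w 2 := fun h => h01 (h02.trans h.symm)
  -- (1) PER-PARTNER LIMITS: `Jp, Jm, D`, with `Jp = Jm = 0` at a compact wall
  have hlim : ∀ ρ : {w : InfinitePlace L // IsComplex w} → Perm (Fin 3), ∃ Jp Jm D : ℂ,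
      Tendsto (G ρ) (𝓝[>] 0) (𝓝 Jp) ∧ Tendsto (G ρ) (𝓝[<] 0) (𝓝 Jm) ∧ Tendsto (fun ψ => deriv (G ρ) ψ) (𝓝[≠] 0) (𝓝 D) ∧
        (0 < (w.1.embedding (α ((ρ w)⁻¹ 0))).re * (w.1.embedding (α ((ρ w)⁻¹ 2))).re → Jp = 0 ∧ Jm = 0) := by
    intro ρ
    rw [hGρ ρ]
    rcases lt_or_gt_of_ne (mul_ne_zero (hne ((ρ w)⁻¹ 0)) (hne ((ρ w)⁻¹ 2))) with hnc | hpos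
    · obtain ⟨Jp, Jm, D, hJp, hJm, hD⟩ := exists_tendsto_two_sin_mul_integral_comp_conj_archDiagTorus_update_splitCurve_comp L α w νw hα hherm Θ hΘ hΘc z hz h02 h01 ρ hnc
      exact ⟨Jp, Jm, D, hJp, hJm, hD, fun h => absurd hnc (not_lt.mpr h.le)⟩
    · obtain ⟨h0, D, hD⟩ := tendsto_two_sin_mul_integral_comp_conj_archDiagTorus_update_splitCurve_comp_of_pos L α w νw hα hherm Θ hΘ hΘc z hz h02 h01 ρ hpos
      exact ⟨0, 0, D, h0.mono_left (nhdsWithin_mono _ fun x hx => ne_of_gt hx), h0.mono_left (nhdsWithin_mono _ fun x hx => ne_of_lt hx), hD, fun _ => ⟨rfl, rfl⟩⟩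
  choose Jp Jm D hJp hJm hD hcw using hlim
  -- (2) THE MIRROR PARTNER `ρ° = update ρ w ((0 2)·ρ_w)`: `g_{ρ°}(ψ) = −g_ρ(−ψ)`, hence `Jm_{ρ°} = −Jp_ρ`
  have hcswap : ∀ ψ : ℝ, c ψ ∘ ⇑(Equiv.swap (0 : Fin 3) 2) = c (-ψ) := by
    intro ψ
    subst hc
    funext i
    fin_cases i <;> simp [Equiv.swap_apply_of_ne_of_ne, h02]
  have hmirror_pt : ∀ (ρ : {w : InfinitePlace L // IsComplex w} → Perm (Fin 3)) (ψ : ℝ),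
      (fun v => Function.update z w (c ψ) v ∘ ⇑(Function.update ρ w (Equiv.swap (0 : Fin 3) 2 * ρ w) v)) =
        fun v => Function.update z w (c (-ψ)) v ∘ ⇑(ρ v) := by
    intro ρ ψ
    funext v
    by_cases hv : v = w
    · subst hv
      rw [Function.update_self, Function.update_self, Function.update_self, Equiv.Perm.coe_mul, ← Function.comp_assoc, hcswap]
    · rw [Function.update_of_ne hv, Function.update_of_ne hv, Function.update_of_ne hv]
  have hmirror : ∀ (ρ : {w : InfinitePlace L // IsComplex w} → Perm (Fin 3)) (ψ : ℝ),
      G (Function.update ρ w (Equiv.swap (0 : Fin 3) 2 * ρ w)) ψ = -G ρ (-ψ) := by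
    intro ρ ψ
    rw [hG]
    dsimp only
    rw [hmirror_pt ρ ψ, Real.sin_neg, Complex.ofReal_neg]
    ring
  have hnegLT : Tendsto (fun ψ : ℝ => -ψ) (𝓝[<] (0 : ℝ)) (𝓝[>] 0) := by
    refine tendsto_nhdsWithin_iff.mpr ⟨?_, ?_⟩
    · simpa using (continuous_neg.tendsto (0 : ℝ)).mono_left nhdsWithin_le_nhds
    · exact eventually_nhdsWithin_of_forall fun x hx => Set.mem_Ioi.mpr (neg_pos.mpr hx)
  have hJm_mirror : ∀ ρ : {w : InfinitePlace L // IsComplex w} → Perm (Fin 3), Jm (Function.update ρ w (Equiv.swap (0 : Fin 3) 2 * ρ w)) = -Jp ρ := by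
    intro ρ
    have h1 := hJm (Function.update ρ w (Equiv.swap (0 : Fin 3) 2 * ρ w))
    have h2 : Tendsto (G (Function.update ρ w (Equiv.swap (0 : Fin 3) 2 * ρ w))) (𝓝[<] 0) (𝓝 (-Jp ρ)) := by
      have h := ((hJp ρ).comp hnegLT).neg
      refine h.congr fun ψ => ?_
      simp only [Function.comp_apply, hmirror]
    exact tendsto_nhds_unique h1 h2
  -- (3) THE SIGN FLIP `K_{ρ°} = −K_ρ` at a noncompact `w`-wall (★ (κ-TABLE))
  have hKflip : ∀ ρ : {w : InfinitePlace L // IsComplex w} → Perm (Fin 3),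
      (w.1.embedding (α ((ρ w)⁻¹ 0))).re * (w.1.embedding (α ((ρ w)⁻¹ 2))).re < 0 →
        K (Function.update ρ w (Equiv.swap (0 : Fin 3) 2 * ρ w)) = -K ρ := by
    intro ρ hnc
    rw [hK, hK, ← Finset.mul_prod_erase Finset.univ _ (Finset.mem_univ w), ← Finset.mul_prod_erase Finset.univ _ (Finset.mem_univ w), Function.update_self,
      Finset.prod_congr rfl fun v hv => by rw [Function.update_of_ne (Finset.ne_of_mem_erase hv)]]
    have h0 : (Equiv.swap (1 : Fin 3) 2 * (Equiv.swap (0 : Fin 3) 2 * ρ w)).symm 1 = (ρ w)⁻¹ 0 := by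
      simp [Equiv.Perm.mul_def, Equiv.swap_apply_left, Equiv.swap_apply_right, Equiv.Perm.inv_def]
    have h2 : (Equiv.swap (1 : Fin 3) 2 * ρ w).symm 1 = (ρ w)⁻¹ 2 := by
      simp [Equiv.Perm.mul_def, Equiv.swap_apply_left, Equiv.Perm.inv_def]
    rw [h0, h2]
    rcases mul_neg_iff.mp hnc with ⟨ha, hb⟩ | ⟨ha, hb⟩
    · rw [sign_pos ha, sign_neg hb]; push_cast; ring
    · rw [sign_neg ha, sign_pos hb]; push_cast; ring
  -- (4) `H(0⁻) = H(0⁺)`: re-index `Σ K_ρ Jm_ρ` by the involution `ρ ↦ ρ°`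
  have hinv : Function.Involutive fun ρ : {w : InfinitePlace L // IsComplex w} → Perm (Fin 3) => Function.update ρ w (Equiv.swap (0 : Fin 3) 2 * ρ w) := by
    intro ρ
    simp only [Function.update_self, Function.update_idem, ← mul_assoc, Equiv.swap_mul_self, one_mul]
    exact Function.update_eq_self w ρ
  have hHpm : ∑ ρ, (K ρ : ℂ) * Jm ρ = ∑ ρ, (K ρ : ℂ) * Jp ρ := by
    rw [← Equiv.sum_comp hinv.toPerm (fun ρ => (K ρ : ℂ) * Jm ρ)]
    refine Finset.sum_congr rfl fun ρ _ => ?_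
    simp only [Function.Involutive.coe_toPerm]
    rw [hJm_mirror ρ]
    rcases lt_or_gt_of_ne (mul_ne_zero (hne ((ρ w)⁻¹ 0)) (hne ((ρ w)⁻¹ 2))) with hnc | hpos
    · rw [hKflip ρ hnc]; push_cast; ring
    · rw [(hcw ρ hpos).1]; simp
  -- (5) THE LAURENT FORM OF `τ·D_{G/H}` ALONG THE CURVE: `= 2 sin ψ · S(ψ)` with `S` entire
  obtain ⟨k, hk⟩ := exists_archTau_mul_archWeylRatio_cayleyTorus_eq L γH hγH μ hμω
  obtain ⟨Cst, hCst⟩ : ∃ Cst : ℂ, Cst = (∏ v ∈ Finset.univ.erase w, -((((z v 0 : ℂ) * (z v 1 : ℂ)) ^ (k v)) * (((z v 2 : ℂ) - (z v 0 : ℂ)) * ((z v 2 : ℂ) - (z v 1 : ℂ))) / (z v 2 : ℂ))) :=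
    ⟨_, rfl⟩
  obtain ⟨S, hS⟩ : ∃ S : ℝ → ℂ, S = fun ψ : ℝ => Cst * (((z w 0 : ℂ) * (z w 1 : ℂ)) ^ (k w) *
      (Complex.I * ((z w 0 : ℂ) * Complex.exp ((k w) * ψ * Complex.I) - (z w 1 : ℂ) * Complex.exp (((k w) + 1) * ψ * Complex.I)))) := ⟨_, rfl⟩
  have hS_smooth : ContDiff ℝ (⊤ : ℕ∞) S := by
    have h1 : ContDiff ℝ (⊤ : ℕ∞) (fun ψ : ℝ => (ψ : ℂ)) := Complex.ofRealCLM.contDiff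
    have hA : ContDiff ℝ (⊤ : ℕ∞) (fun ψ : ℝ => Complex.exp ((k w) * ψ * Complex.I)) := Complex.contDiff_exp.comp ((contDiff_const.mul h1).mul contDiff_const)
    have hB : ContDiff ℝ (⊤ : ℕ∞) (fun ψ : ℝ => Complex.exp (((k w) + 1) * ψ * Complex.I)) := Complex.contDiff_exp.comp ((contDiff_const.mul h1).mul contDiff_const)
    rw [hS]
    exact contDiff_const.mul (contDiff_const.mul (contDiff_const.mul ((contDiff_const.mul hA).sub (contDiff_const.mul hB))))
  have hc0 : ∀ ψ : ℝ, ((c ψ 0 : Circle) : ℂ) = (z w 0 : ℂ) * Complex.exp (ψ * Complex.I) := by intro ψ; subst hc; simp [Circle.coe_exp]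
  have hc1 : ∀ ψ : ℝ, ((c ψ 1 : Circle) : ℂ) = (z w 1 : ℂ) := by intro ψ; subst hc; simp
  have hc2 : ∀ ψ : ℝ, ((c ψ 2 : Circle) : ℂ) = (z w 0 : ℂ) * Complex.exp (-(ψ * Complex.I)) := by intro ψ; subst hc; simp [Circle.coe_exp, h02, Complex.exp_neg]
  have hT : ∀ ψ : ℝ, archTau L (γH fun v => Function.update z w (c ψ) v ∘ ⇑(Equiv.swap (1 : Fin 3) 2)) μ *
      (archWeylRatio L (γH fun v => Function.update z w (c ψ) v ∘ ⇑(Equiv.swap (1 : Fin 3) 2)) : ℂ) = (2 * Real.sin ψ : ℂ) * S ψ := by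
    intro ψ
    rw [hk, ← Finset.mul_prod_erase Finset.univ _ (Finset.mem_univ w)]
    have hw : -(((((Function.update z w (c ψ) w ∘ ⇑(Equiv.swap (1 : Fin 3) 2)) 0 : Circle) : ℂ) * (((Function.update z w (c ψ) w ∘ ⇑(Equiv.swap (1 : Fin 3) 2)) 2 : Circle) : ℂ)) ^ (k w) *
        (((((Function.update z w (c ψ) w ∘ ⇑(Equiv.swap (1 : Fin 3) 2)) 1 : Circle) : ℂ) - (((Function.update z w (c ψ) w ∘ ⇑(Equiv.swap (1 : Fin 3) 2)) 0 : Circle) : ℂ)) *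
          ((((Function.update z w (c ψ) w ∘ ⇑(Equiv.swap (1 : Fin 3) 2)) 1 : Circle) : ℂ) - (((Function.update z w (c ψ) w ∘ ⇑(Equiv.swap (1 : Fin 3) 2)) 2 : Circle) : ℂ))) /
          (((Function.update z w (c ψ) w ∘ ⇑(Equiv.swap (1 : Fin 3) 2)) 1 : Circle) : ℂ)) =
        (2 * Real.sin ψ : ℂ) * (((z w 0 : ℂ) * (z w 1 : ℂ)) ^ (k w) *
          (Complex.I * ((z w 0 : ℂ) * Complex.exp ((k w) * ψ * Complex.I) - (z w 1 : ℂ) * Complex.exp (((k w) + 1) * ψ * Complex.I)))) := by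
      simp only [Function.update_self, Function.comp_apply, Equiv.swap_apply_left, Equiv.swap_apply_right,
        Equiv.swap_apply_of_ne_of_ne (show (0 : Fin 3) ≠ 1 by decide) (show (0 : Fin 3) ≠ 2 by decide), hc0, hc1, hc2]
      exact gWall_place_factor_eq (z w 0 : ℂ) (z w 1 : ℂ) (Circle.coe_ne_zero _) (k w) ψ
    rw [hw, Finset.prod_congr rfl fun v hv => by rw [Function.update_of_ne (Finset.ne_of_mem_erase hv)]]
    rw [hS, hCst]
    simp only [Function.comp_apply, Equiv.swap_apply_left, Equiv.swap_apply_right,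
      Equiv.swap_apply_of_ne_of_ne (show (0 : Fin 3) ≠ 1 by decide) (show (0 : Fin 3) ≠ 2 by decide)]
    ring
  -- (6) `Δ″`-TERMS: `Δ″(γ_H(y(ψ)), t(z^ψ∘ρ)) = K_ρ · (τ·D)(γ_H(y(ψ)))` (★ (Δ-def-explicit))
  have hΔ : ∀ (ρ : {w : InfinitePlace L // IsComplex w} → Perm (Fin 3)) (ψ : ℝ),
      archExplicitDelta L (Matrix.diagonal α) (γH fun v => Function.update z w (c ψ) v ∘ ⇑(Equiv.swap (1 : Fin 3) 2)) μ
          (archDiagTorus L 3 α fun v => Function.update z w (c ψ) v ∘ ⇑(ρ v)) = (K ρ : ℂ) * ((2 * Real.sin ψ : ℂ) * S ψ) := by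
    intro ρ ψ
    have hpart : (fun v => (Function.update z w (c ψ) v ∘ ⇑(Equiv.swap (1 : Fin 3) 2)) ∘ ⇑(Equiv.swap (1 : Fin 3) 2 * ρ v)) =
        fun v => Function.update z w (c ψ) v ∘ ⇑(ρ v) := by
      funext v i
      simp [Equiv.swap_apply_self]
    have h := archExplicitDelta_cayleyTorus_relabel_eq_mul L α γH hγH μ (fun v => Function.update z w (c ψ) v ∘ ⇑(Equiv.swap (1 : Fin 3) 2)) (fun v => Equiv.swap (1 : Fin 3) 2 * ρ v)
    simp only [hpart] at h
    rw [h, hT ψ, hK ρ]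
  -- (7) `F = S · H` with `H = Σ_ρ K_ρ · g_ρ`
  have hF : (fun ψ : ℝ => ∑ ρ : {w : InfinitePlace L // IsComplex w} → Perm (Fin 3),
      archExplicitDelta L (Matrix.diagonal α) (γH fun v => Function.update z w (c ψ) v ∘ ⇑(Equiv.swap (1 : Fin 3) 2)) μ
          (archDiagTorus L 3 α fun v => Function.update z w (c ψ) v ∘ ⇑(ρ v)) *
        ∫ g, Θ (((g * archDiagTorus L 3 α (fun v => Function.update z w (c ψ) v ∘ ⇑(ρ v)) * g⁻¹ :
          arch (↥(maximalRealSubfield L)) L (IsCMField.complexConj L) 3 (Matrix.diagonal α)) : GL (Fin 3) (mixedSpace L)) : Matrix (Fin 3) (Fin 3) (mixedSpace L))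
          ∂((Measure.pi νw).map (archPiEquivCM 3 L (Matrix.diagonal α)).symm)) =
      fun ψ => S ψ * ∑ ρ : {w : InfinitePlace L // IsComplex w} → Perm (Fin 3), (K ρ : ℂ) * G ρ ψ := by
    funext ψ
    rw [Finset.mul_sum]
    refine Finset.sum_congr rfl fun ρ _ => ?_
    rw [hΔ ρ ψ, hG]
    dsimp only
    ring
  rw [hF]
  -- (8) LIMITS OF `H` AND `H′`
  have hTev : ∀ᶠ ψ in 𝓝[≠] (0 : ℝ), Function.Injective (c ψ) := by
    simp only [hcψ]; exact eventually_injective_splitCurve (z w) h02 h01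
  have hGdiff : ∀ ρ : {w : InfinitePlace L // IsComplex w} → Perm (Fin 3), ∀ ψ : ℝ, Function.Injective (c ψ) → DifferentiableAt ℝ (G ρ) ψ := by
    intro ρ ψ hψ
    rw [hGρ ρ]
    rw [hcψ ψ] at hψ
    exact differentiableAt_two_sin_mul_integral_comp_conj_archDiagTorus_update_splitCurve_comp L α w νw hα hherm Θ hΘ hΘc z hz ρ hψ
  have hHp : Tendsto (fun ψ => ∑ ρ : {w : InfinitePlace L // IsComplex w} → Perm (Fin 3), (K ρ : ℂ) * G ρ ψ) (𝓝[>] 0) (𝓝 (∑ ρ, (K ρ : ℂ) * Jp ρ)) :=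
    tendsto_finsetSum _ fun ρ _ => (hJp ρ).const_mul _
  have hHm : Tendsto (fun ψ => ∑ ρ : {w : InfinitePlace L // IsComplex w} → Perm (Fin 3), (K ρ : ℂ) * G ρ ψ) (𝓝[<] 0) (𝓝 (∑ ρ, (K ρ : ℂ) * Jp ρ)) := by
    rw [← hHpm]
    exact tendsto_finsetSum _ fun ρ _ => (hJm ρ).const_mul _
  have hH : Tendsto (fun ψ => ∑ ρ : {w : InfinitePlace L // IsComplex w} → Perm (Fin 3), (K ρ : ℂ) * G ρ ψ) (𝓝[≠] 0) (𝓝 (∑ ρ, (K ρ : ℂ) * Jp ρ)) := by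
    rw [← nhdsLT_sup_nhdsGT]
    exact hHm.sup hHp
  have hHderiv : ∀ ψ : ℝ, Function.Injective (c ψ) →
      HasDerivAt (fun ψ => ∑ ρ : {w : InfinitePlace L // IsComplex w} → Perm (Fin 3), (K ρ : ℂ) * G ρ ψ) (∑ ρ, (K ρ : ℂ) * deriv (G ρ) ψ) ψ :=
    fun ψ hψ => HasDerivAt.fun_sum fun ρ _ => ((hGdiff ρ ψ hψ).hasDerivAt).const_mul _
  have hH' : Tendsto (fun ψ => deriv (fun ψ => ∑ ρ : {w : InfinitePlace L // IsComplex w} → Perm (Fin 3), (K ρ : ℂ) * G ρ ψ) ψ) (𝓝[≠] 0)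
      (𝓝 (∑ ρ, (K ρ : ℂ) * D ρ)) := by
    refine (tendsto_finsetSum _ fun ρ _ => (hD ρ).const_mul (K ρ : ℂ)).congr' ?_
    filter_upwards [hTev] with ψ hψ
    exact ((hHderiv ψ hψ).deriv).symm
  -- (9) `F = S·H`, `F′ = S′H + SH′`
  have hS0 : Tendsto S (𝓝[≠] 0) (𝓝 (S 0)) := (hS_smooth.continuous.tendsto 0).mono_left nhdsWithin_le_nhds
  have hS1 : ∀ ψ, HasDerivAt S (deriv S ψ) ψ := fun ψ => ((hS_smooth.differentiable (by simp)) ψ).hasDerivAt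
  have hS'0 : Tendsto (fun ψ => deriv S ψ) (𝓝[≠] 0) (𝓝 (deriv S 0)) :=
    ((hS_smooth.continuous_deriv (by exact_mod_cast le_top)).tendsto 0).mono_left nhdsWithin_le_nhds
  refine ⟨S 0 * ∑ ρ, (K ρ : ℂ) * Jp ρ, deriv S 0 * (∑ ρ, (K ρ : ℂ) * Jp ρ) + S 0 * ∑ ρ, (K ρ : ℂ) * D ρ, hS0.mul hH, ?_⟩
  refine ((hS'0.mul hH).add (hS0.mul hH')).congr' ?_
  filter_upwards [hTev] with ψ hψ
  rw [(hHderiv ψ hψ).deriv]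
  exact (((hS1 ψ).fun_mul (hHderiv ψ hψ)).deriv).symm


include hγH in
open scoped Classical in
/-- **(M2-01-curve) — THE `Δ″`-SIDE OF `Θ` IS `C¹` ACROSS A `G`-WALL ALONG THE NORMAL CURVE.**  In the setting of the module docstring (base `z` regular off `w`, `z_{w,0} = z_{w,2} ≠ z_{w,1}`,
`H`-point `y(ψ) = (z^ψ_v ∘ (1 2))_v`, partners `t(z^ψ ∘ ρ)`, `μ|_{𝔸_{L⁺}^×} = ω_{L/L⁺}`): there are `A B : ℂ` with
`F(ψ) = Σ_ρ Δ″(γ_H(y(ψ)), t(z^ψ∘ρ))·∫_{G′_∞} Θ(↑↑(g·t(z^ψ∘ρ)·g⁻¹)) dν_∞ → A` and `F′(ψ) → B` as `ψ → 0`, `ψ ≠ 0` (both sides).  Mirror partners cancel the jumps of the unstable orbital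
integrals at the noncompact walls (`K_{ρ°} = −K_ρ`, ★ (κ-TABLE)); compact walls have none; the simple zero of `D_{G/H}` is absorbed by `2 sin ψ`.
[cite: Rogawski1990, §8.2 pp. 122–124] [cite: Shelstad1979, §4] [cite: Varadarajan1989, §6.4 Thm 18, Thm 20, Thm 22] -/
theorem exists_tendsto_sum_archExplicitDelta_mul_integral_splitCurve_gWall
    (νw : ∀ v : {w : InfinitePlace L // IsComplex w}, Measure (archLocal L 3 (Matrix.diagonal α) v)) [∀ v, (νw v).IsHaarMeasure]
    (hα : ∀ i, α i ≠ 0) (hherm : ∀ i, (IsCMField.complexConj L (α i) : L) = α i)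
    (hμω : ∀ x : ideleGroup ↥(maximalRealSubfield L), μ (AdeleRing.ideleBaseChange (↥(maximalRealSubfield L)) L x) = quadraticHeckeCharCM L x)
    (Θ : Matrix (Fin 3) (Fin 3) (mixedSpace L) → ℂ) (hΘ : ContDiff ℝ (⊤ : ℕ∞) Θ)
    (hΘc : HasCompactSupport fun g : arch (↥(maximalRealSubfield L)) L (IsCMField.complexConj L) 3 (Matrix.diagonal α) => Θ ((g : GL (Fin 3) (mixedSpace L)) : Matrix (Fin 3) (Fin 3) (mixedSpace L)))
    (z : {w : InfinitePlace L // IsComplex w} → Fin 3 → Circle) (hz : ∀ v, v ≠ w → Function.Injective (z v)) (h02 : z w 0 = z w 2) (h01 : z w 0 ≠ z w 1) :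
    ∃ A B : ℂ,
      Tendsto (fun ψ : ℝ => ∑ ρ : {w : InfinitePlace L // IsComplex w} → Perm (Fin 3),
          archExplicitDelta L (Matrix.diagonal α) (γH fun v => Function.update z w (fun i => z w i * Circle.exp (![(1 : ℝ), 0, -1] i * ψ)) v ∘ ⇑(Equiv.swap (1 : Fin 3) 2)) μ
              (archDiagTorus L 3 α fun v => Function.update z w (fun i => z w i * Circle.exp (![(1 : ℝ), 0, -1] i * ψ)) v ∘ ⇑(ρ v)) *
            ∫ g, Θ (((g * archDiagTorus L 3 α (fun v => Function.update z w (fun i => z w i * Circle.exp (![(1 : ℝ), 0, -1] i * ψ)) v ∘ ⇑(ρ v)) * g⁻¹ :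
              arch (↥(maximalRealSubfield L)) L (IsCMField.complexConj L) 3 (Matrix.diagonal α)) : GL (Fin 3) (mixedSpace L)) : Matrix (Fin 3) (Fin 3) (mixedSpace L))
              ∂((Measure.pi νw).map (archPiEquivCM 3 L (Matrix.diagonal α)).symm)) (𝓝[≠] 0) (𝓝 A) ∧
      Tendsto (fun ψ : ℝ => deriv (fun ψ : ℝ => ∑ ρ : {w : InfinitePlace L // IsComplex w} → Perm (Fin 3),
          archExplicitDelta L (Matrix.diagonal α) (γH fun v => Function.update z w (fun i => z w i * Circle.exp (![(1 : ℝ), 0, -1] i * ψ)) v ∘ ⇑(Equiv.swap (1 : Fin 3) 2)) μ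
              (archDiagTorus L 3 α fun v => Function.update z w (fun i => z w i * Circle.exp (![(1 : ℝ), 0, -1] i * ψ)) v ∘ ⇑(ρ v)) *
            ∫ g, Θ (((g * archDiagTorus L 3 α (fun v => Function.update z w (fun i => z w i * Circle.exp (![(1 : ℝ), 0, -1] i * ψ)) v ∘ ⇑(ρ v)) * g⁻¹ :
              arch (↥(maximalRealSubfield L)) L (IsCMField.complexConj L) 3 (Matrix.diagonal α)) : GL (Fin 3) (mixedSpace L)) : Matrix (Fin 3) (Fin 3) (mixedSpace L))
              ∂((Measure.pi νw).map (archPiEquivCM 3 L (Matrix.diagonal α)).symm)) ψ) (𝓝[≠] 0) (𝓝 B) :=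
  exists_tendsto_sum_archExplicitDelta_mul_integral_splitCurve_gWall_aux L α w γH hγH μ νw hα hherm hμω Θ hΘ hΘc z hz h02 h01 _ rfl

end GWall

end Literature.NumberTheory.Rogawski1990

end
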